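import Summits.KontsevichZagierPeriods.Zeta5Search.WellPoisedFaceTailRate
import HarnessLib

/-!
# ζ(5) search — the boundary lemma for ANY number of tail bricks, II: sizes, decay, the sandwich, the rate of `F`
and the DECAY FLOOR (cell `pub-zeta5`, fam-odd gen 8, file B; census item R12 of families/odd/FAMILY.md §9)

HONEST FRAMING: systematic search; no irrationality claim unless certified.

Continues `WellPoisedFaceTailRate.lean` (same namespace; `tailR` = Zudilin's `R(t)` on the numerator-free face with
`B` tail bricks [cite: Zudilin2004, §8 (8.2), (8.6), (8.7)], `tailF = ½ Σ_{t∈ℕ} R″(t)`, `R″ = R·(dlogT² + d2logT)`).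
Verbatim the `q = 7` arguments of fam-vwp's `WellPoisedFaceConvexity` §7–8 and `WellPoisedFaceSandwich` §9 with the
brick count `4` replaced by `B` in the constants:
* T5 sizes on `t ≥ 0`: `|(log R)′| ≤ 1 + B h₀`, `(log R)″ ≤ B h₀`, hence `0 < R″ ≤ (B+1)² h₀² R` (`B ≥ 2`);
* T6 decay (`B ≥ 3`): `R(t) ≤ 2h₀²/(t+h₀)² · R(0)` (each brick loses a factor `h₀/(t+h₀)` — file 3's `block_decay`,
  reused by name — and three of them pay for `h₀ + 2t` and for summability);
* T7 the series converges, `F > 0`, SANDWICH `2 R(0)/h₀² ≤ F ≤ ((B+1)²π²/6)·h₀⁴·R(0)`, and the RATE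
  `tendsto_log_tailF_div : (1/n) log F_n → −Σ_j blockRate η₀ η_j` for every integral face direction `2η_j < η₀`;
* T8 **the decay floor** `tailF_decay_floor : ∀ ε > 0, ∀ᶠ n, exp(−(Σ_j blockRate η₀ η_j + ε)·n) ≤ F_n`
  (and `≤ |F_n|`), i.e. exactly the hypothesis `hF` of `IntFaceDir.faceLambda_eventually_ge` /
  `faceLambda_tendsto_atTop(_le_six)` (`WellPoisedFaceOddGrowth`, `WellPoisedFaceZeta579Growth`) once
  `Σ_{j : Fin (M+2)}` is split as `a + Σ_mid + d = FaceDirM.C0` — done in the corollary file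
  `WellPoisedFaceOddGrowthFree`.
The constants are crude (only polynomial dependence on `h₀` matters for the rate).  `B ≥ 3` covers every box
`q ≥ 6`, in particular `q = 7` (fam-vwp, `B = 4`) and the odd-window boxes `q = 8, …, 11` (`B = 5, …, 8`).
Standard axioms only.
-/

noncomputable section

open Real Filter Topology Finset

namespace Summit.KontsevichZagierPeriods.Zeta5Search.WellPoisedFaceRate

open Summit.KontsevichZagierPeriods.Zeta5Search.WellPoisedFace (blockRate)

variable {B : ℕ}

/-! ## T5. Signs and sizes on `t ≥ 0` -/

/-- the colour-`j` brick has at most `h₀` poles (file 3's `range_card_le`, brick by brick). -/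
theorem tail_range_card_le (η₀ : ℕ) (η : Fin B → ℕ) (n : ℕ) (j : Fin B) :
    (∑ _i ∈ Finset.range ((η₀ * n + 2) - 2 * (η j * n + 1) + 1), (1 : ℝ)) ≤ ((η₀ * n + 2 : ℕ) : ℝ) :=
  range_card_le η₀ (fun _ : Fin 4 => η j) n 0

/-- `Σ_j Σ_i 1/(t+h_j+i) ≤ B·h₀` for `t ≥ 0`. -/
theorem polesumT_le (η₀ : ℕ) (η : Fin B → ℕ) (n : ℕ) {t : ℝ} (ht : 0 ≤ t) :
    (∑ j : Fin B, ∑ i ∈ Finset.range ((η₀ * n + 2) - 2 * (η j * n + 1) + 1),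
      1 / (t + ((η j * n + 1 : ℕ) : ℝ) + (i : ℝ))) ≤ B * ((η₀ * n + 2 : ℕ) : ℝ) := by
  have hpole := tail_pole_pos η n (by linarith : -1/2 < t)
  have hj : ∀ j : Fin B, (∑ i ∈ Finset.range ((η₀ * n + 2) - 2 * (η j * n + 1) + 1),
      1 / (t + ((η j * n + 1 : ℕ) : ℝ) + (i : ℝ))) ≤ ((η₀ * n + 2 : ℕ) : ℝ) := by
    intro j
    refine le_trans (Finset.sum_le_sum fun i _ => ?_) (tail_range_card_le η₀ η n j)
    rw [div_le_one (hpole j i)]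
    have h1 : (1 : ℝ) ≤ ((η j * n + 1 : ℕ) : ℝ) := by exact_mod_cast Nat.le_add_left 1 _
    have h2 : (0 : ℝ) ≤ (i : ℝ) := Nat.cast_nonneg _
    linarith
  calc _ ≤ ∑ _j : Fin B, ((η₀ * n + 2 : ℕ) : ℝ) := Finset.sum_le_sum fun j _ => hj j
    _ = B * ((η₀ * n + 2 : ℕ) : ℝ) := by
      simp only [Finset.sum_const, Finset.card_univ, Fintype.card_fin, nsmul_eq_mul]

/-- `Σ_j Σ_i 1/(t+h_j+i)² ≤ B·h₀` for `t ≥ 0`. -/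
theorem polesumT_sq_le (η₀ : ℕ) (η : Fin B → ℕ) (n : ℕ) {t : ℝ} (ht : 0 ≤ t) :
    (∑ j : Fin B, ∑ i ∈ Finset.range ((η₀ * n + 2) - 2 * (η j * n + 1) + 1),
      1 / (t + ((η j * n + 1 : ℕ) : ℝ) + (i : ℝ)) ^ 2) ≤ B * ((η₀ * n + 2 : ℕ) : ℝ) := by
  have hpole := tail_pole_pos η n (by linarith : -1/2 < t)
  refine le_trans (Finset.sum_le_sum fun j _ => Finset.sum_le_sum fun i _ => ?_) (polesumT_le η₀ η n ht)
  have h1 : (1 : ℝ) ≤ ((η j * n + 1 : ℕ) : ℝ) := by exact_mod_cast Nat.le_add_left 1 _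
  have h2 : (0 : ℝ) ≤ (i : ℝ) := Nat.cast_nonneg _
  have hx : 1 ≤ t + ((η j * n + 1 : ℕ) : ℝ) + (i : ℝ) := by linarith
  apply one_div_le_one_div_of_le (hpole j i)
  nlinarith

/-- `|(log R)′(t)| ≤ 1 + B·h₀` for `t ≥ 0`. -/
theorem abs_dlogT_le (η₀ : ℕ) (η : Fin B → ℕ) (n : ℕ) {t : ℝ} (ht : 0 ≤ t) :
    |dlogT η₀ η n t| ≤ 1 + B * ((η₀ * n + 2 : ℕ) : ℝ) := by
  have ht' : -1/2 < t := by linarith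
  have hlin := lin_pos η₀ n ht'
  have hpole := tail_pole_pos η n ht'
  have h2le : 2 / ((((η₀ * n + 2 : ℕ) : ℝ) + 2 * t)) ≤ 1 := by
    rw [div_le_one hlin]
    have : (2 : ℝ) ≤ ((η₀ * n + 2 : ℕ) : ℝ) := by exact_mod_cast Nat.le_add_left 2 _
    linarith
  have h2nn : 0 ≤ 2 / ((((η₀ * n + 2 : ℕ) : ℝ) + 2 * t)) := by positivity
  have hS := polesumT_le η₀ η n ht
  have hSnn : 0 ≤ ∑ j : Fin B, ∑ i ∈ Finset.range ((η₀ * n + 2) - 2 * (η j * n + 1) + 1),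
      1 / (t + ((η j * n + 1 : ℕ) : ℝ) + (i : ℝ)) :=
    Finset.sum_nonneg fun j _ => Finset.sum_nonneg fun i _ => (one_div_pos.mpr (hpole j i)).le
  have hB0 : 0 ≤ (B : ℝ) * ((η₀ * n + 2 : ℕ) : ℝ) := by positivity
  unfold dlogT
  rw [abs_le]; constructor <;> linarith

/-- `(log R)″(t) ≤ B·h₀` for `t ≥ 0`. -/
theorem d2logT_le (η₀ : ℕ) (η : Fin B → ℕ) (n : ℕ) {t : ℝ} (ht : 0 ≤ t) :
    d2logT η₀ η n t ≤ B * ((η₀ * n + 2 : ℕ) : ℝ) := by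
  have hlin := lin_pos η₀ n (by linarith : -1/2 < t)
  have hneg : -4 / ((((η₀ * n + 2 : ℕ) : ℝ) + 2 * t)) ^ 2 ≤ 0 :=
    div_nonpos_of_nonpos_of_nonneg (by norm_num) (by positivity)
  unfold d2logT
  linarith [polesumT_sq_le η₀ η n ht]

/-- `(log R)′² + (log R)″ ≤ (B+1)² h₀²` on `t ≥ 0` (uses `h₀ ≥ 2`). -/
theorem bracketT_le (η₀ : ℕ) (η : Fin B → ℕ) (n : ℕ) {t : ℝ} (ht : 0 ≤ t) :
    dlogT η₀ η n t ^ 2 + d2logT η₀ η n t ≤ ((B : ℝ) + 1) ^ 2 * ((η₀ * n + 2 : ℕ) : ℝ) ^ 2 := by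
  have ha := abs_dlogT_le η₀ η n ht
  have hb := d2logT_le η₀ η n ht
  have h2 : (2 : ℝ) ≤ ((η₀ * n + 2 : ℕ) : ℝ) := by exact_mod_cast Nat.le_add_left 2 _
  have hB0 : (0 : ℝ) ≤ B := Nat.cast_nonneg B
  have hsq : dlogT η₀ η n t ^ 2 ≤ (1 + B * ((η₀ * n + 2 : ℕ) : ℝ)) ^ 2 := by
    rw [← sq_abs]
    exact pow_le_pow_left₀ (abs_nonneg _) ha 2
  nlinarith [mul_nonneg hB0 (by linarith : (0 : ℝ) ≤ ((η₀ * n + 2 : ℕ) : ℝ)),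
    mul_le_mul h2 h2 (by norm_num) (by linarith)]

/-- `0 < R″(t)` for `t ≥ 0` (`B ≥ 2` bricks). -/
theorem iteratedDeriv_two_tailR_pos (hB : 2 ≤ B) (η₀ : ℕ) (η : Fin B → ℕ) (hη : ∀ j, 2 * η j < η₀) (n : ℕ)
    {t : ℝ} (ht : 0 ≤ t) : 0 < iteratedDeriv 2 (tailR η₀ η n) t := by
  rw [iteratedDeriv_two_tailR η₀ η n (by linarith : -1/2 < t)]
  exact mul_pos (tailR_pos η₀ η n (by linarith)) (by nlinarith [d2logT_pos hB η₀ η hη n ht])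

/-- `R″(t) ≤ (B+1)² h₀² · R(t)` for `t ≥ 0`. -/
theorem iteratedDeriv_two_tailR_le (η₀ : ℕ) (η : Fin B → ℕ) (n : ℕ) {t : ℝ} (ht : 0 ≤ t) :
    iteratedDeriv 2 (tailR η₀ η n) t ≤ ((B : ℝ) + 1) ^ 2 * ((η₀ * n + 2 : ℕ) : ℝ) ^ 2 * tailR η₀ η n t := by
  rw [iteratedDeriv_two_tailR η₀ η n (by linarith : -1/2 < t)]
  have hR := tailR_pos η₀ η n (by linarith : -1/2 < t)
  nlinarith [bracketT_le η₀ η n ht]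

/-! ## T6. Polynomial decay of `R` on `t ≥ 0` (`B ≥ 3` bricks) -/

/-- DECAY: `R(t) ≤ 2h₀²/(t+h₀)² · R(0)` for `t ≥ 0`, from three of the `B ≥ 3` brick factors `h₀/(t+h₀)`
(file 3's `block_decay`, brick by brick). -/
theorem tailR_decay (hB : 3 ≤ B) (η₀ : ℕ) (η : Fin B → ℕ) (hη : ∀ j, 2 * η j < η₀) (n : ℕ) {t : ℝ}
    (ht : 0 ≤ t) :
    tailR η₀ η n t ≤ 2 * ((η₀ * n + 2 : ℕ) : ℝ) ^ 2 / (t + ((η₀ * n + 2 : ℕ) : ℝ)) ^ 2 * tailR η₀ η n 0 := by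
  set h0 : ℝ := ((η₀ * n + 2 : ℕ) : ℝ) with hh0
  have h0pos : 0 < h0 := by rw [hh0]; positivity
  have ht0 : 0 < t + h0 := by linarith
  have hpole := tail_pole_pos η n (by linarith : -1/2 < t)
  have hpole0 := tail_pole_pos η n (by norm_num : -1/2 < (0 : ℝ))
  have hprod : (∏ j : Fin B, ((((η₀ * n + 2) - 2 * (η j * n + 1)).factorial : ℕ) : ℝ)
        / ∏ i ∈ Finset.range ((η₀ * n + 2) - 2 * (η j * n + 1) + 1),
            (t + ((η j * n + 1 : ℕ) : ℝ) + (i : ℝ)))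
      ≤ (h0 / (t + h0)) ^ B * ∏ j : Fin B, ((((η₀ * n + 2) - 2 * (η j * n + 1)).factorial : ℕ) : ℝ)
        / ∏ i ∈ Finset.range ((η₀ * n + 2) - 2 * (η j * n + 1) + 1),
            ((0 : ℝ) + ((η j * n + 1 : ℕ) : ℝ) + (i : ℝ)) := by
    have h := Finset.prod_le_prod (s := (Finset.univ : Finset (Fin B)))
      (fun j _ => div_nonneg (Nat.cast_nonneg _)
        (Finset.prod_nonneg fun i _ => (hpole j i).le))
      (fun j _ => block_decay η₀ (fun _ : Fin 4 => η j) (fun _ => hη j) n 0 ht)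
    rw [Finset.prod_mul_distrib, Finset.prod_const, Finset.card_univ, Fintype.card_fin] at h
    exact h
  have hP0 : 0 ≤ ∏ j : Fin B, ((((η₀ * n + 2) - 2 * (η j * n + 1)).factorial : ℕ) : ℝ)
        / ∏ i ∈ Finset.range ((η₀ * n + 2) - 2 * (η j * n + 1) + 1),
            ((0 : ℝ) + ((η j * n + 1 : ℕ) : ℝ) + (i : ℝ)) :=
    Finset.prod_nonneg fun j _ => div_nonneg (Nat.cast_nonneg _)
      (Finset.prod_nonneg fun i _ => (hpole0 j i).le)
  have hlin : 0 ≤ h0 + 2 * t := by linarith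
  have hq1 : h0 / (t + h0) ≤ 1 := by rw [div_le_one ht0]; linarith
  have hpow : (h0 / (t + h0)) ^ B ≤ (h0 / (t + h0)) ^ 3 := pow_le_pow_of_le_one (by positivity) hq1 hB
  have hcoef : (h0 + 2 * t) * (h0 / (t + h0)) ^ B ≤ 2 * h0 ^ 2 / (t + h0) ^ 2 * (h0 + 2 * 0) := by
    refine (mul_le_mul_of_nonneg_left hpow hlin).trans ?_
    rw [mul_zero, add_zero, div_pow, ← mul_div_assoc, div_mul_eq_mul_div,
      div_le_div_iff₀ (by positivity) (by positivity)]
    have h3 : (t + h0) ^ 3 = (t + h0) ^ 2 * (t + h0) := by ring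
    rw [h3]
    have hA : 0 < (t + h0) ^ 2 := by positivity
    have hC : 0 < h0 ^ 3 := by positivity
    nlinarith [mul_pos (mul_pos hA hC) h0pos]
  unfold tailR
  simp only [mul_zero, add_zero] at hcoef ⊢
  calc (h0 + 2 * t) * ∏ j : Fin B, ((((η₀ * n + 2) - 2 * (η j * n + 1)).factorial : ℕ) : ℝ)
        / ∏ i ∈ Finset.range ((η₀ * n + 2) - 2 * (η j * n + 1) + 1),
            (t + ((η j * n + 1 : ℕ) : ℝ) + (i : ℝ))
      ≤ (h0 + 2 * t) * ((h0 / (t + h0)) ^ B * ∏ j : Fin B,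
          ((((η₀ * n + 2) - 2 * (η j * n + 1)).factorial : ℕ) : ℝ)
          / ∏ i ∈ Finset.range ((η₀ * n + 2) - 2 * (η j * n + 1) + 1),
            ((0 : ℝ) + ((η j * n + 1 : ℕ) : ℝ) + (i : ℝ))) :=
        mul_le_mul_of_nonneg_left hprod hlin
    _ = ((h0 + 2 * t) * (h0 / (t + h0)) ^ B) * ∏ j : Fin B,
          ((((η₀ * n + 2) - 2 * (η j * n + 1)).factorial : ℕ) : ℝ)
          / ∏ i ∈ Finset.range ((η₀ * n + 2) - 2 * (η j * n + 1) + 1),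
            ((0 : ℝ) + ((η j * n + 1 : ℕ) : ℝ) + (i : ℝ)) := by ring
    _ ≤ (2 * h0 ^ 2 / (t + h0) ^ 2 * h0) * ∏ j : Fin B,
          ((((η₀ * n + 2) - 2 * (η j * n + 1)).factorial : ℕ) : ℝ)
          / ∏ i ∈ Finset.range ((η₀ * n + 2) - 2 * (η j * n + 1) + 1),
            ((0 : ℝ) + ((η j * n + 1 : ℕ) : ℝ) + (i : ℝ)) :=
        mul_le_mul_of_nonneg_right hcoef hP0
    _ = _ := by ring

/-! ## T7. Summability, the sandwich and the unconditional rate of `F` (`B ≥ 3` bricks) -/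

/-- Termwise domination of `R″(t)`, `t ∈ ℕ`, by the summable `1/(t+1)²`. -/
theorem iteratedDeriv_two_tailR_le_shift_sq (hB : 3 ≤ B) (η₀ : ℕ) (η : Fin B → ℕ) (hη : ∀ j, 2 * η j < η₀)
    (n t : ℕ) :
    iteratedDeriv 2 (tailR η₀ η n) (t : ℝ)
      ≤ 2 * ((B : ℝ) + 1) ^ 2 * ((η₀ * n + 2 : ℕ) : ℝ) ^ 4 * tailR η₀ η n 0 * (1 / ((t : ℝ) + 1) ^ 2) := by
  set h0 : ℝ := ((η₀ * n + 2 : ℕ) : ℝ) with hh0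
  have ht : (0 : ℝ) ≤ t := Nat.cast_nonneg t
  have h0two : 2 ≤ h0 := by rw [hh0]; exact_mod_cast Nat.le_add_left 2 _
  have hR0 : 0 < tailR η₀ η n 0 := tailR_pos η₀ η n (by norm_num)
  have h1 := iteratedDeriv_two_tailR_le η₀ η n ht
  have h2 := tailR_decay hB η₀ η hη n ht
  have h3 : 1 / ((t : ℝ) + h0) ^ 2 ≤ 1 / ((t : ℝ) + 1) ^ 2 := by
    apply one_div_le_one_div_of_le (by positivity)
    exact pow_le_pow_left₀ (by positivity) (by linarith) 2
  calc iteratedDeriv 2 (tailR η₀ η n) (t : ℝ)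
      ≤ ((B : ℝ) + 1) ^ 2 * h0 ^ 2 * tailR η₀ η n t := h1
    _ ≤ ((B : ℝ) + 1) ^ 2 * h0 ^ 2 * (2 * h0 ^ 2 / ((t : ℝ) + h0) ^ 2 * tailR η₀ η n 0) :=
        mul_le_mul_of_nonneg_left h2 (by positivity)
    _ = 2 * ((B : ℝ) + 1) ^ 2 * h0 ^ 4 * tailR η₀ η n 0 * (1 / ((t : ℝ) + h0) ^ 2) := by ring
    _ ≤ 2 * ((B : ℝ) + 1) ^ 2 * h0 ^ 4 * tailR η₀ η n 0 * (1 / ((t : ℝ) + 1) ^ 2) :=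
        mul_le_mul_of_nonneg_left h3 (by positivity)

/-- the series (8.6) defining `F` converges (positive terms, dominated by `1/(t+1)²`). -/
theorem tailF_summable (hB : 3 ≤ B) (η₀ : ℕ) (η : Fin B → ℕ) (hη : ∀ j, 2 * η j < η₀) (n : ℕ) :
    Summable (fun t : ℕ => iteratedDeriv 2 (tailR η₀ η n) (t : ℝ)) :=
  Summable.of_nonneg_of_le
    (fun t => (iteratedDeriv_two_tailR_pos (le_trans (by norm_num) hB) η₀ η hη n (Nat.cast_nonneg t)).le)
    (fun t => iteratedDeriv_two_tailR_le_shift_sq hB η₀ η hη n t)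
    (summable_shift_sq.mul_left _)

/-- `F > 0`: a series of positive terms. -/
theorem tailF_pos (hB : 3 ≤ B) (η₀ : ℕ) (η : Fin B → ℕ) (hη : ∀ j, 2 * η j < η₀) (n : ℕ) :
    0 < tailF η₀ η n := by
  have hB2 : 2 ≤ B := le_trans (by norm_num) hB
  unfold tailF
  have h := (tailF_summable hB η₀ η hη n).le_tsum 0
    (fun t _ => (iteratedDeriv_two_tailR_pos hB2 η₀ η hη n (Nat.cast_nonneg t)).le)
  have h0 := iteratedDeriv_two_tailR_pos hB2 η₀ η hη n (le_refl (0 : ℝ))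
  simp only [Nat.cast_zero] at h
  linarith

/-- UPPER half of the sandwich: `F ≤ ((B+1)²π²/6) · h₀⁴ · R(0)`. -/
theorem tailF_le (hB : 3 ≤ B) (η₀ : ℕ) (η : Fin B → ℕ) (hη : ∀ j, 2 * η j < η₀) (n : ℕ) :
    tailF η₀ η n ≤ (((B : ℝ) + 1) ^ 2 * π ^ 2 / 6) * ((η₀ * n + 2 : ℕ) : ℝ) ^ 4 * tailR0 η₀ η n := by
  unfold tailF
  have hb := (hasSum_shift_sq.mul_left (2 * ((B : ℝ) + 1) ^ 2 * ((η₀ * n + 2 : ℕ) : ℝ) ^ 4 * tailR η₀ η n 0))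
  have hle := Summable.tsum_le_tsum (fun t => iteratedDeriv_two_tailR_le_shift_sq hB η₀ η hη n t)
    (tailF_summable hB η₀ η hη n) hb.summable
  rw [hb.tsum_eq, tailR_zero η₀ η hη n] at hle
  have : (1 / 2 : ℝ) * (2 * ((B : ℝ) + 1) ^ 2 * ((η₀ * n + 2 : ℕ) : ℝ) ^ 4 * tailR0 η₀ η n * (π ^ 2 / 6))
      = (((B : ℝ) + 1) ^ 2 * π ^ 2 / 6) * ((η₀ * n + 2 : ℕ) : ℝ) ^ 4 * tailR0 η₀ η n := by ring
  linarith

/-- LOWER half of the sandwich: `2 R(0)/h₀² ≤ F` (the `t = 0` term alone: `(log R)′(0) ≤ −2/h₀`,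
`(log R)″(0) > 0`). -/
theorem le_tailF (hB : 3 ≤ B) (η₀ : ℕ) (η : Fin B → ℕ) (hη : ∀ j, 2 * η j < η₀) (n : ℕ) :
    2 * tailR0 η₀ η n / ((η₀ * n + 2 : ℕ) : ℝ) ^ 2 ≤ tailF η₀ η n := by
  have hB2 : 2 ≤ B := le_trans (by norm_num) hB
  set h0 : ℝ := ((η₀ * n + 2 : ℕ) : ℝ) with hh0
  have h0pos : 0 < h0 := by rw [hh0]; positivity
  unfold tailF
  have h := (tailF_summable hB η₀ η hη n).le_tsum 0
    (fun t _ => (iteratedDeriv_two_tailR_pos hB2 η₀ η hη n (Nat.cast_nonneg t)).le)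
  simp only [Nat.cast_zero] at h
  rw [iteratedDeriv_two_tailR η₀ η n (by norm_num : -1/2 < (0 : ℝ)), tailR_zero η₀ η hη n] at h
  have hR0 : 0 < tailR0 η₀ η n := tailR0_pos η₀ η hη n
  have hd2 := d2logT_pos hB2 η₀ η hη n (le_refl (0 : ℝ))
  have hd1 := dlogT_zero_le hB2 η₀ η hη n
  have hsq : (2 / h0) ^ 2 ≤ dlogT η₀ η n 0 ^ 2 := by
    rw [← neg_sq (dlogT η₀ η n 0)]
    apply pow_le_pow_left₀ (by positivity)
    rw [neg_div] at hd1; linarith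
  have : 2 * tailR0 η₀ η n / h0 ^ 2 = (1 / 2 : ℝ) * (tailR0 η₀ η n * ((2 / h0) ^ 2 + 0)) := by
    field_simp; ring
  rw [this]
  refine le_trans ?_ (mul_le_mul_of_nonneg_left h (by norm_num))
  apply mul_le_mul_of_nonneg_left _ (by norm_num)
  exact mul_le_mul_of_nonneg_left (add_le_add hsq hd2.le) hR0.le

/-- BOUNDARY LEMMA (ii)+(iii) for `B ≥ 3` bricks, unconditional: `(1/n) log F_n → −Σ_j blockRate η₀ η_j`. -/
theorem tendsto_log_tailF_div (hB : 3 ≤ B) (η₀ : ℕ) (η : Fin B → ℕ) (hη : ∀ j, 2 * η j < η₀) :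
    Tendsto (fun n : ℕ => Real.log (tailF η₀ η n) / n) atTop (𝓝 (-∑ j : Fin B, blockRate η₀ (η j))) := by
  set C : ℝ := ∑ j : Fin B, blockRate (η₀ : ℝ) (η j : ℝ) with hC
  set K : ℝ := ((B : ℝ) + 1) ^ 2 * π ^ 2 / 6 with hK
  have hKpos : 0 < K := by rw [hK]; positivity
  have hR : Tendsto (fun n : ℕ => Real.log (tailR0 η₀ η n) / n) atTop (𝓝 (-C)) :=
    tendsto_log_tailR0_div η₀ η hη
  have hh : Tendsto (fun n : ℕ => Real.log ((η₀ * n + 2 : ℕ) : ℝ) / n) atTop (𝓝 0) := by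
    have := tendsto_log_linear_div (c := (η₀ : ℝ)) (d := 2) (Nat.cast_nonneg η₀) zero_le_two
    exact this.congr' (Eventually.of_forall fun n => by norm_cast)
  have hc2 : Tendsto (fun n : ℕ => Real.log 2 / (n : ℝ)) atTop (𝓝 0) :=
    tendsto_const_div_atTop_nhds_zero_nat _
  have hcK : Tendsto (fun n : ℕ => Real.log K / (n : ℝ)) atTop (𝓝 0) :=
    tendsto_const_div_atTop_nhds_zero_nat _
  have hlow : Tendsto (fun n : ℕ => Real.log 2 / n + Real.log (tailR0 η₀ η n) / n
      - 2 * (Real.log ((η₀ * n + 2 : ℕ) : ℝ) / n)) atTop (𝓝 (0 + -C - 2 * 0)) :=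
    (hc2.add hR).sub (hh.const_mul 2)
  have hup : Tendsto (fun n : ℕ => Real.log K / n + 4 * (Real.log ((η₀ * n + 2 : ℕ) : ℝ) / n)
      + Real.log (tailR0 η₀ η n) / n) atTop (𝓝 (0 + 4 * 0 + -C)) :=
    (hcK.add (hh.const_mul 4)).add hR
  rw [mul_zero, sub_zero, zero_add] at hlow
  rw [mul_zero, add_zero, zero_add] at hup
  refine tendsto_of_tendsto_of_tendsto_of_le_of_le' hlow hup ?_ ?_
  · filter_upwards [eventually_gt_atTop 0] with n hpos
    have hR0 : 0 < tailR0 η₀ η n := tailR0_pos η₀ η hη n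
    have hh0 : (0 : ℝ) < ((η₀ * n + 2 : ℕ) : ℝ) := by positivity
    have hL : 0 < 2 * tailR0 η₀ η n / ((η₀ * n + 2 : ℕ) : ℝ) ^ 2 := by positivity
    have hn' : (0 : ℝ) < n := by exact_mod_cast hpos
    have hlog := Real.log_le_log hL (le_tailF hB η₀ η hη n)
    rw [Real.log_div (by positivity) (by positivity), Real.log_mul (by norm_num) hR0.ne',
      Real.log_pow] at hlog
    push_cast at hlog
    have key : (Real.log 2 + Real.log (tailR0 η₀ η n) - 2 * Real.log ((η₀ * n + 2 : ℕ) : ℝ)) / n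
        ≤ Real.log (tailF η₀ η n) / n := div_le_div_of_nonneg_right (by push_cast; linarith) hn'.le
    calc Real.log 2 / n + Real.log (tailR0 η₀ η n) / n - 2 * (Real.log ((η₀ * n + 2 : ℕ) : ℝ) / n)
        = (Real.log 2 + Real.log (tailR0 η₀ η n) - 2 * Real.log ((η₀ * n + 2 : ℕ) : ℝ)) / n := by
          ring
      _ ≤ Real.log (tailF η₀ η n) / n := key
  · filter_upwards [eventually_gt_atTop 0] with n hpos
    have hR0 : 0 < tailR0 η₀ η n := tailR0_pos η₀ η hη n
    have hh0 : (0 : ℝ) < ((η₀ * n + 2 : ℕ) : ℝ) := by positivity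
    have hF : 0 < tailF η₀ η n := tailF_pos hB η₀ η hη n
    have hn' : (0 : ℝ) < n := by exact_mod_cast hpos
    have hlog := Real.log_le_log hF (tailF_le hB η₀ η hη n)
    rw [Real.log_mul (by positivity) hR0.ne', Real.log_mul hKpos.ne' (by positivity),
      Real.log_pow] at hlog
    push_cast at hlog
    have key : Real.log (tailF η₀ η n) / n
        ≤ (Real.log K + 4 * Real.log ((η₀ * n + 2 : ℕ) : ℝ) + Real.log (tailR0 η₀ η n)) / n :=
      div_le_div_of_nonneg_right (by push_cast; linarith) hn'.le
    calc Real.log (tailF η₀ η n) / n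
        ≤ (Real.log K + 4 * Real.log ((η₀ * n + 2 : ℕ) : ℝ) + Real.log (tailR0 η₀ η n)) / n := key
      _ = Real.log K / n + 4 * (Real.log ((η₀ * n + 2 : ℕ) : ℝ) / n)
          + Real.log (tailR0 η₀ η n) / n := by ring

/-! ## T8. The decay floor = hypothesis `hF` of the odd-window face growth theorem -/

/-- **THE DECAY FLOOR** (`B ≥ 3` bricks, every integral face direction): for every `ε > 0`, eventually
`exp(−(Σ_j blockRate η₀ η_j + ε)·n) ≤ F_n`. -/
theorem tailF_decay_floor (hB : 3 ≤ B) (η₀ : ℕ) (η : Fin B → ℕ) (hη : ∀ j, 2 * η j < η₀) {ε : ℝ}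
    (hε : 0 < ε) :
    ∀ᶠ n : ℕ in atTop, Real.exp (-(∑ j : Fin B, blockRate η₀ (η j) + ε) * n) ≤ tailF η₀ η n := by
  have h := (tendsto_order.1 (tendsto_log_tailF_div hB η₀ η hη)).1
    (-(∑ j : Fin B, blockRate (η₀ : ℝ) (η j : ℝ)) - ε) (by linarith)
  filter_upwards [h, eventually_gt_atTop 0] with n hn hpos
  have hn' : (0 : ℝ) < n := by exact_mod_cast hpos
  have hF : 0 < tailF η₀ η n := tailF_pos hB η₀ η hη n
  rw [← Real.log_le_log_iff (Real.exp_pos _) hF, Real.log_exp]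
  rw [lt_div_iff₀ hn'] at hn
  have : -(∑ j : Fin B, blockRate (η₀ : ℝ) (η j : ℝ) + ε) * n
      = (-(∑ j : Fin B, blockRate (η₀ : ℝ) (η j : ℝ)) - ε) * n := by ring
  linarith

/-- The decay floor in the `|F_n|` shape of `IntFaceDir.faceLambda_eventually_ge`'s hypothesis `hF`. -/
theorem tailF_abs_decay_floor (hB : 3 ≤ B) (η₀ : ℕ) (η : Fin B → ℕ) (hη : ∀ j, 2 * η j < η₀) (ε : ℝ)
    (hε : 0 < ε) :
    ∀ᶠ n : ℕ in atTop, Real.exp (-(∑ j : Fin B, blockRate η₀ (η j) + ε) * n) ≤ |tailF η₀ η n| :=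
  (tailF_decay_floor hB η₀ η hη hε).mono fun _ hn => hn.trans (le_abs_self _)

end Summit.KontsevichZagierPeriods.Zeta5Search.WellPoisedFaceRate

end
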